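import Literature.MathematicalPhysics.QuantumFieldTheory.OSPointAssembly
import Literature.MathematicalPhysics.QuantumFieldTheory.OSPointLowOrders
import Literature.MathematicalPhysics.QuantumFieldTheory.OSPointOneOrder
import HarnessLib

/-!
# (A1) `OS1975_exists_timeContinuation` from the temperedness estimate (4.5), all orders

Topic `Literature/MathematicalPhysics/QuantumFieldTheory`; support file (all proved; no named
facts) for the discharge of (A1) `OS1975_exists_timeContinuation`: the all-`n` form of
`OSPointAssembly.timeContinuation_of_sumBound` (`n ≥ 2`) with the degenerate orders `n = 0`
(`OSPointLowOrders.timeContinuation_zero`) and `n = 1` (`OSPointOneOrder.timeContinuation_one`),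
for an OS family (`IsOSFamily`: E1, E2 used) with E0'. The only remaining hypothesis is
`HasPointSumBound` — Osterwalder–Schrader II, Thm. 4.1, estimate (4.5) as printed (exponent linear
in the number of points, constants of geometric defect), proved in OS II Ch. VI.1 and not yet
formalised; with it, `OS1975_exists_timeContinuation` (and through
`OSLorentzInvariantOfTimeContinuation.OS1975_exists_continuation_halfSpace_of_A1` the half-space
fact (A₁₂⁺)) follows.

* `timeContinuation_of_sumBound_all` — for every `n`, the five conjuncts of (A1).

## References

* K. Osterwalder, R. Schrader, *Axioms for Euclidean Green's functions II*, Comm. Math. Phys.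
  42 (1975) 281–305, §IV.2 Thms. 4.1–4.3; Ch. V–VI. [OsterwalderSchraderCMP1975]
-/

noncomputable section

open MeasureTheory Set
open scoped SchwartzMap

namespace Literature.MathematicalPhysics.QuantumFieldTheory

open Literature.MathematicalPhysics.QuantumLattice (SchwingerFamily SpaceTime complexifyPoint euclideanPoint IsTimeOrdered)
open Literature.MathematicalPhysics.QuantumLattice.SchwingerFamily

/-- **(A1) for an OS family with E0', all orders, from the sum-form temperedness estimate (4.5).** [cite: OsterwalderSchraderCMP1975, §IV.2 Thm. 4.3; Ch. V–VI] -/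
theorem timeContinuation_of_sumBound_all {d : ℕ} [NeZero d] (S : SchwingerFamily (SpaceTime d))
    (hOS : S.IsOSFamily) (hE0 : S.HasLinearGrowth) {t : ℕ} {γ : ℝ} {m : ℕ} {α₀ : ℕ → ℝ}
    (hsb : HasPointSumBound hOS.covariant hOS.reflectionPositive hE0 t γ m α₀) (n : ℕ) :
    ∃ 𝔚 : (Fin n → Fin (d + 1) → ℂ) → ℂ,
      ContinuousOn 𝔚 (timeTube d n) ∧ IsTimeHolomorphicOn 𝔚 (timeTube d n) ∧
        (∀ z ∈ timeTube d n, ∀ a : SpaceTime d, 𝔚 (fun k => z k + complexifyPoint a) = 𝔚 z) ∧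
        HasOSGrowth 𝔚 ∧
        ∀ F : 𝓢((Fin n → SpaceTime d), ℂ), IsTimeOrdered F →
          S n F = ∫ x : Fin n → SpaceTime d, 𝔚 (euclideanPoint x) * F x := by
  match n with
  | 0 => exact timeContinuation_zero S
  | 1 => exact timeContinuation_one S hOS.covariant
  | k' + 2 => exact timeContinuation_of_sumBound hOS.covariant hOS.reflectionPositive hE0 hsb k'

/-- **The shape of the reduction**: if the sum-form temperedness estimate (4.5) holds for every OS
family with E0', then (A1) `OS1975_exists_timeContinuation` holds. [cite: OsterwalderSchraderCMP1975, §IV.2 Thm. 4.3] -/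
theorem OS1975_exists_timeContinuation_of_sumBound
    (h : ∀ (d : ℕ) [NeZero d] (S : SchwingerFamily (SpaceTime d)) (hOS : S.IsOSFamily) (hE0 : S.HasLinearGrowth),
      ∃ (t : ℕ) (γ : ℝ) (m : ℕ) (α₀ : ℕ → ℝ), HasPointSumBound hOS.covariant hOS.reflectionPositive hE0 t γ m α₀) :
    OS1975_exists_timeContinuation := by
  intro d _ S hOS hE0 n
  obtain ⟨t, γ, m, α₀, hsb⟩ := h d S hOS hE0
  exact timeContinuation_of_sumBound_all S hOS hE0 hsb n

end Literature.MathematicalPhysics.QuantumFieldTheory
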